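import Literature.AnabelianGeometry.SemiGraphs.SectionFibreWalkStepsOver
import HarnessLib

/-!
# Section fibres along a restricted covering saturate — LOCALISED labels ([SemiAnbd] §2, Cor. 2.7 (i) p. 30)

Mochizuki, *Semi-graphs of anabelioids*, Publ. RIMS **42** (2006), §2, proof of Cor. 2.7 (i) p. 30
("`ℋ′` injects into `𝒢′` as a subgraph": the restriction of the finite étale covering attached to
`A` to a preimage component of `ℍ` is the covering of `𝒢_ℍ` attached to a component of `A|_ℍ`)
[cite: MochizukiSemiAnbd2006, Cor. 2.7(i) p.30]; Def. 2.2 (i) p. 23.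

PROOF-ONLY (abc-iut cell, layer L3; FACT-LIST row F-1487 `covering_subgraphComponents_doubleCosets`
AS TYPED, CLASS route, brick R6c «LOCALISED TIE», file E2b (part 2); seat abc-iut-f-161 (gen 13),
L3-lead ζ3; SHAPES `HOME/staging/f/f-161/g13/SHAPES-R6c.md`).  abc-iut-L3-d3's sheet walk
`Hom.sectionFibres_saturate` consumes the TIE's label binders — injectivity of the vertex labels on all
of `𝒢′`, surjectivity of the edge labels onto all cells — only through its step
`walkStep_vertex_to_edge` (localised in part 1) and once more at the end, to identify two vertices OF THE
PREIMAGE COMPONENT `K` with equal labels.  Two distinct vertices of the connected `K` are told apart by a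
branch of `K` at the first, whose image is a branch of `ℍ`; so injectivity among vertices over the end
of an `ℍ`-branch suffices.  This file re-runs the sheet walk on the localised binders:

* `SemiGraph.Subgraph.exists_branch_of_isConnected_of_ne` — in a connected sub-semi-graph two distinct
  vertices are told apart by a branch of the sub-semi-graph at the first (first step of a walk in the
  barycentric subdivision, read through `SemiGraph.subdivision_adj_inl_iff`; the tree's
  `SemiGraph.exists_abuts_of_isConnected` is the edge-to-vertex analogue);
* `Hom.sectionFibres_saturate_over` — abc-iut-L3-d3's `sectionFibres_saturate` with the two label
  binders LOCALISED to `ℍ` (all other binders byte-identical, proof verbatim but for the step and the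
  final identification).

No definition, no instance, no new named fact; a strict generalisation (weaker hypotheses, same
conclusion) of the tree theorem, which is not restated.
Consolidation TODO (not tonight, abc-iut-L3-lead ζ11): the tree's global theorems are the
`S = univ` + connected corollaries of the `_over` / `…On` forms and could be re-derived from them.
typed ≠ proved for F-1487 AS TYPED (OPEN-AS-TYPED, L3-lead δ22); CLASS route ≠ the fact; nothing
here takes a side on [IUTchIII] Cor. 3.12.
-/

namespace Literature.AnabelianGeometry.SemiGraphs

open CategoryTheory CategoryTheory.Limits CategoryTheory.PreGaloisCategory
open Literature.AnabelianGeometry.Anabelioids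

universe v₁ u₁ u

/-! ### Two distinct vertices of a connected sub-semi-graph are told apart by a branch -/

/-- In a CONNECTED sub-semi-graph `K ⊆ 𝔾`, for two distinct vertices `w₁ ≠ w₂` of `K` some branch of
`𝔾` whose edge lies in `K` abuts to `w₁` (the first step of a walk from `w₁` to `w₂` in the barycentric
subdivision of `K` leaves `w₁` through a branch-point). [cite: MochizukiSemiAnbd2006, §1 pp.11-12] -/
theorem SemiGraph.Subgraph.exists_branch_of_isConnected_of_ne {G : SemiGraph.{u}} (K : G.Subgraph)
    (hK : K.toSemiGraph.IsConnected) {w₁ w₂ : G.Vertex} (h₁ : w₁ ∈ K.verts) (h₂ : w₂ ∈ K.verts)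
    (hne : w₁ ≠ w₂) : ∃ b : G.Branch, G.edgeOf b ∈ K.edges ∧ G.abuts b = some w₁ := by
  obtain ⟨p⟩ := hK.connected.preconnected (Sum.inl ⟨w₁, h₁⟩) (Sum.inl ⟨w₂, h₂⟩)
  cases p with
  | nil => exact absurd rfl hne
  | cons hadj _ =>
    -- the neighbours of a vertex-point are branch-points (`subdivision_adj_inl_iff`)
    obtain ⟨b, hb, -⟩ := (K.toSemiGraph.subdivision_adj_inl_iff _ _).mp hadj
    exact ⟨b.1, b.2, (SemiGraph.Subgraph.abuts_eq_some_iff K b ⟨w₁, h₁⟩).mp hb⟩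

namespace SemiGraphOfAnabelioids

variable {𝒢 𝒢' : SemiGraphOfAnabelioids.{v₁, u₁, u}}

/-! ### The sheet walk on LOCALISED labels -/

/-- **Section fibres saturate, LOCALISED labels.**  Let `φ : 𝒢′ → 𝒢` lie over a proper morphism,
with labels `oV`, `oE`
(`w ↦ (φ w, oV w)`, `e′ ↦ (φ e′, oE e′)` bijective onto the components of the `A_v`, `A_e`; branch
clause) through which a section `s : T → φ^* A` factors (`T` with terminal constituents), and with
vertex alignment at the section points of the vertices of a preimage component `K` of the connected
sub-graph `ℍ` (a graph); let `Y ∈ B(𝒢_ℍ)` be CONNECTED with `f : Y → A|_ℍ` and `j : W ↪ ψ^* Y`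
(`ψ = φ|_K`) a sub-object.  If some `F₀(W_{w₀})`, `w₀ ∈ K`, contains a point whose image in
`F₀(φ_{w₀}^* Y_{u₀})` lies over the section point, then for EVERY `w₁ ∈ K`, every basepoint `F₁` and
every point `η` of `F₁(φ_{w₁}^* Y_{u₁})` over the section point, `η ∈ F₁(W_{w₁})`.  Sheet walk on the
incidence semi-graph of `Y` (connected by (D8)): the predicates «`c ⊆ Y_u` is labelled by `oV w` and
`Ψ_c ⊆ W_w` for some `w ∈ K` over `u`» / «`W_{e′}` meets `Ψ_d` for some `e′ ∈ K` over `e`» are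
constant along incidences (parts C, D), hold at the component of the given point, and their witnesses
are pinned by the injectivity of the vertex labels — here only among vertices over the end of an
`ℍ`-branch (enough: two distinct vertices of the connected `K` are told apart at a `K`-branch of the
first, `SemiGraph.Subgraph.exists_branch_of_isConnected_of_ne`), the edge labels being surjective only
onto the cells over `ℍ.edges`.  abc-iut-L3-d3's `sectionFibres_saturate` verbatim on the localised
binders. [cite: MochizukiSemiAnbd2006, Cor. 2.7(i) p.30] -/
theorem Hom.sectionFibres_saturate_over (φ : Hom 𝒢' 𝒢) (A : 𝒢.BObj) (H : 𝒢.graph.Subgraph)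
    (K : 𝒢'.graph.Subgraph) (hKV : K.verts ⊆ φ.base.vertexMap ⁻¹' H.verts)
    (hKE : K.edges ⊆ φ.base.edgeMap ⁻¹' H.edges) (hK : φ.IsPreimageComponent H K)
    (hprop : SemiGraph.IsProper φ.base) (hHg : H.toSemiGraph.IsGraph) (hH : H.toSemiGraph.IsConnected)
    (T : 𝒢'.BObj) (hTV : ∀ v', IsTerminal (T.S v')) (hTE : ∀ e', IsTerminal (T.T e'))
    (s : T ⟶ φ.pullbackFunctor.obj A)
    (oV : ∀ v' : 𝒢'.graph.Vertex, π₀Obj (A.S (φ.base.vertexMap v')))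
    (oE : ∀ e' : 𝒢'.graph.Edge, π₀Obj (A.T (φ.base.edgeMap e')))
    (hoV : ∀ (w₁ w₂ : 𝒢'.graph.Vertex) (b : 𝒢.graph.Branch), 𝒢.graph.edgeOf b ∈ H.edges →
      𝒢.graph.abuts b = some (φ.base.vertexMap w₁) →
      (⟨φ.base.vertexMap w₁, oV w₁⟩ : Σ v, π₀Obj (A.S v)) = ⟨φ.base.vertexMap w₂, oV w₂⟩ → w₁ = w₂)
    (hoE : ∀ e ∈ H.edges, ∀ Q : π₀Obj (A.T e), ∃ e' : 𝒢'.graph.Edge,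
      (⟨φ.base.edgeMap e', oE e'⟩ : Σ e, π₀Obj (A.T e)) = ⟨e, Q⟩)
    (hobr : ∀ (b' : 𝒢'.graph.Branch) (v' : 𝒢'.graph.Vertex) (h' : 𝒢'.graph.abuts b' = some v'),
      ∃ f : ((oE (𝒢'.graph.edgeOf b')).1 : 𝒢.E (φ.base.edgeMap (𝒢'.graph.edgeOf b'))) ⟶
          (𝒢.transportE (φ.base.edgeOf_branchMap b')).obj
            ((𝒢.pull (φ.base.branchMap b') (φ.base.vertexMap v')
              (φ.base.abuts_branchMap b' v' h')).pullback.obj ((oV v').1 : 𝒢.V (φ.base.vertexMap v'))),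
        f ≫ (𝒢.transportE (φ.base.edgeOf_branchMap b')).map
              ((𝒢.pull _ _ (φ.base.abuts_branchMap b' v' h')).pullback.map (oV v').1.arrow ≫
                (A.ψ (φ.base.branchMap b') (φ.base.vertexMap v') (φ.base.abuts_branchMap b' v' h')).hom) ≫
            eqToHom (𝒢.transportE_obj_T A (φ.base.edgeOf_branchMap b')) =
          (oE (𝒢'.graph.edgeOf b')).1.arrow)
    (hsV : ∀ v', ∃ k : T.S v' ⟶ (φ.φV v').pullback.obj (oV v').1,
      k ≫ (φ.φV v').pullback.map (oV v').1.arrow = s.fS v')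
    (hsE : ∀ e', ∃ k : T.T e' ⟶ (φ.φE e' (φ.base.edgeMap e') rfl).pullback.obj (oE e').1,
      k ≫ (φ.φE e' (φ.base.edgeMap e') rfl).pullback.map (oE e').1.arrow = s.fT e')
    (hVAK : ∀ (w : 𝒢'.graph.Vertex) (_ : w ∈ K.verts) (F' : 𝒢'.V w ⥤ FintypeCat.{v₁}) [FiberFunctor F']
      (F : 𝒢.V (φ.base.vertexMap w) ⥤ FintypeCat.{v₁}) [FiberFunctor F]
      (e : (φ.φV w).pullback ⋙ F' ≅ F) (t : F'.obj (T.S w)),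
      MulAction.stabilizer (Aut F) (e.hom.app (A.S (φ.base.vertexMap w)) (F'.map (s.fS w) t)) ≤
        ((Aut.autMulEquivOfIso e).toMonoidHom.comp (pi1Map (φ.φV w).pullback F')).range)
    (Y : (𝒢.restrict H).BObj) (hY : PreGaloisCategory.IsConnected Y)
    (f : Y ⟶ (𝒢.restrictFunctor H).obj A)
    {W : (𝒢'.restrict K).BObj} (j : W ⟶ (φ.restrict K H hKV hKE).pullbackFunctor.obj Y) [Mono j]
    (w₀ : 𝒢'.graph.Vertex) (hw₀ : w₀ ∈ K.verts) (F₀ : 𝒢'.V w₀ ⥤ FintypeCat.{v₁}) [FiberFunctor F₀]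
    (t₀ : F₀.obj (T.S w₀)) (ω₀ : F₀.obj (W.S ⟨w₀, hw₀⟩))
    (hω₀ : F₀.map ((φ.φV w₀).pullback.map (f.fS ⟨φ.base.vertexMap w₀, hKV hw₀⟩))
      (F₀.map (j.fS ⟨w₀, hw₀⟩) ω₀) = F₀.map (s.fS w₀) t₀)
    (w₁ : 𝒢'.graph.Vertex) (hw₁ : w₁ ∈ K.verts) (F₁ : 𝒢'.V w₁ ⥤ FintypeCat.{v₁}) [FiberFunctor F₁]
    (t₁ : F₁.obj (T.S w₁)) (η : F₁.obj ((φ.φV w₁).pullback.obj (Y.S ⟨φ.base.vertexMap w₁, hKV hw₁⟩)))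
    (hη : F₁.map ((φ.φV w₁).pullback.map (f.fS ⟨φ.base.vertexMap w₁, hKV hw₁⟩)) η =
      F₁.map (s.fS w₁) t₁) :
    η ∈ Set.range (F₁.map (j.fS ⟨w₁, hw₁⟩)) := by
  classical
  -- the incidence semi-graph of `Y` over `ℍ` is connected ((D8) for the covering of `𝒢_ℍ` attached to `Y`)
  have hΓ : Y.fibreData.total.IsConnected :=
    (covering_isConnected_holds (𝒢.restrict H) Y.coveringGraph Y.coveringHom Y ⟨hH⟩
      Y.coveringHom_isFiniteEtaleCoveringOf hY).isConnected
  -- the predicates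
  let LAB : ∀ (w : 𝒢'.graph.Vertex) (hw : w ∈ K.verts), π₀Obj (Y.S ⟨φ.base.vertexMap w, hKV hw⟩) → Prop :=
    fun w hw c => ∃ m : (Subobject.underlying.obj c.1 : 𝒢.V (φ.base.vertexMap w)) ⟶
        Subobject.underlying.obj (oV w).1,
      m ≫ (oV w).1.arrow = c.1.arrow ≫ f.fS ⟨φ.base.vertexMap w, hKV hw⟩
  let FAC : ∀ (w : 𝒢'.graph.Vertex) (hw : w ∈ K.verts), π₀Obj (Y.S ⟨φ.base.vertexMap w, hKV hw⟩) → Prop :=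
    fun w hw c => ∃ g : pullback ((φ.φV w).pullback.map (c.1.arrow ≫ f.fS ⟨φ.base.vertexMap w, hKV hw⟩))
        (s.fS w) ⟶ W.S ⟨w, hw⟩,
      g ≫ j.fS ⟨w, hw⟩ = pullback.fst ((φ.φV w).pullback.map
        (c.1.arrow ≫ f.fS ⟨φ.base.vertexMap w, hKV hw⟩)) (s.fS w) ≫ (φ.φV w).pullback.map c.1.arrow
  let QV : Y.fibreData.total.Vertex → Prop := fun vc =>
    ∃ (w : 𝒢'.graph.Vertex) (hw : w ∈ K.verts) (_ : φ.base.vertexMap w = vc.1.1)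
      (c₀ : π₀Obj (Y.S ⟨φ.base.vertexMap w, hKV hw⟩)), HEq c₀ (Y.vComp vc) ∧ LAB w hw c₀ ∧ FAC w hw c₀
  let MEETS : ∀ (e' : 𝒢'.graph.Edge) (he' : e' ∈ K.edges) (e₁ : 𝒢.graph.Edge) (he₁ : e₁ ∈ H.edges)
      (p : φ.base.edgeMap e' = e₁), π₀Obj (Y.T ⟨e₁, he₁⟩) → Prop :=
    fun e' he' e₁ he₁ p d => ∃ (Fe : 𝒢'.E e' ⥤ FintypeCat.{v₁}) (_ : FiberFunctor Fe)
      (π : Fe.obj (pullback ((φ.φE e' e₁ p).pullback.map (d.1.arrow ≫ f.fT ⟨e₁, he₁⟩))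
        (s.fT e' ≫ (φ.reindexIso e' (φ.base.edgeMap e') e₁ rfl p).hom.app A)))
      (ϖ : Fe.obj (W.T ⟨e', he'⟩)),
      Fe.map (j.fT ⟨e', he'⟩ ≫ ((φ.restrict K H hKV hKE).reindexIso ⟨e', he'⟩
          ⟨e₁, he₁⟩ ⟨φ.base.edgeMap e', hKE he'⟩ (Subtype.ext p) rfl).inv.app Y) ϖ =
        Fe.map (pullback.fst _ _ ≫ (φ.φE e' e₁ p).pullback.map d.1.arrow) π
  let QE : Y.fibreData.total.Edge → Prop := fun ec =>
    ∃ (e' : 𝒢'.graph.Edge) (he' : e' ∈ K.edges) (p : φ.base.edgeMap e' = ec.1.1),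
      MEETS e' he' ec.1.1 ec.1.2 p (Y.eComp ec)
  let Q : Y.fibreData.total.Node → Prop :=
    Sum.elim QV (Sum.elim QE (fun bc => QE (Y.fibreData.total.edgeOf bc)))
  -- the predicates are constant along incidences
  have hstep : ∀ (bc : Y.fibreData.total.Branch) (vc : Y.fibreData.total.Vertex),
      Y.fibreData.total.abuts bc = some vc → (QE (Y.fibreData.total.edgeOf bc) ↔ QV vc) := by
    rintro ⟨⟨b₁, hb₁H⟩, dd⟩ ⟨⟨u₁, hu₁⟩, cc⟩ hbv
    have hb₁u : 𝒢.graph.abuts b₁ = some u₁ :=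
      (SemiGraph.Subgraph.abuts_eq_some_iff H _ _).mp (BObj.abuts_fst hbv)
    have hdc := BObj.brComp_le_branchImage hbv
    constructor
    · rintro ⟨e', he', p, Fe, hFe, π, ϖ, hϖ⟩
      haveI := hFe
      obtain ⟨w, hw, hwu, c₀, hc₀, hlab, hfac⟩ := φ.walkStep_edge_to_vertex A H K hKV hKE hK hprop T hTV
        hTE s oV oE hobr hsE hVAK Y f j e' he' b₁ hb₁H p u₁ hu₁ hb₁u (Y.vComp ⟨⟨u₁, hu₁⟩, cc⟩)
        (Y.brComp ⟨⟨b₁, hb₁H⟩, dd⟩) hdc Fe π ϖ hϖ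
      exact ⟨w, hw, hwu, c₀, hc₀, hlab, hfac⟩
    · rintro ⟨w, hw, hwu, c₀, hc₀, hlab, hfac⟩
      change φ.base.vertexMap w = u₁ at hwu
      subst hwu
      obtain rfl : c₀ = Y.vComp ⟨⟨φ.base.vertexMap w, hu₁⟩, cc⟩ := eq_of_heq hc₀
      obtain ⟨e', he', p, Fe, hFe, π, ϖ, hϖ⟩ := φ.walkStep_vertex_to_edge_over A H K hKV hKE hK hprop hHg T
        hTV hTE s oV oE hoV hoE hobr hsE Y f j w hw b₁ hb₁H hb₁u _ (Y.brComp ⟨⟨b₁, hb₁H⟩, dd⟩) hdc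
        hlab hfac
      exact ⟨e', he', p, Fe, hFe, π, ϖ, hϖ⟩
  have hrel : ∀ {x y}, Y.fibreData.total.NodeRel x y → (Q x ↔ Q y) := by
    rintro _ _ (⟨bc⟩ | ⟨bc, vc, hbv⟩)
    · exact Iff.rfl
    · exact hstep bc vc hbv
  have hadj : ∀ {x y}, Y.fibreData.total.subdivision.Adj x y → (Q x ↔ Q y) := fun hxy =>
    ((SemiGraph.subdivision_adj_iff _).mp hxy).elim (fun h => hrel h) (fun h => (hrel h).symm)
  have hwalk : ∀ {x y} (_ : Y.fibreData.total.subdivision.Walk x y), (Q x ↔ Q y) := by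
    intro x y q
    induction q with
    | nil => exact Iff.rfl
    | cons hxy _ ih => exact (hadj hxy).trans ih
  have hconst : ∀ x y, (Q x ↔ Q y) := fun x y => by
    obtain ⟨q⟩ := hΓ.connected.preconnected x y
    exact hwalk q
  -- the start node: the component of `Y_{u₀}` through the image of `ω₀`
  let Φ₀ : 𝒢.V (φ.base.vertexMap w₀) ⥤ 𝒢'.V w₀ := (φ.φV w₀).pullback
  haveI : PreservesFiniteLimits Φ₀ := (φ.φV w₀).property.1
  haveI : PreservesFiniteColimits Φ₀ := (φ.φV w₀).property.2
  let FY₀ : 𝒢.V (φ.base.vertexMap w₀) ⥤ FintypeCat.{v₁} := Φ₀ ⋙ F₀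
  haveI : FiberFunctor FY₀ := fiberFunctor_comp_of_exact _ _
  let YS₀ : 𝒢.V (φ.base.vertexMap w₀) := Y.S ⟨φ.base.vertexMap w₀, hKV hw₀⟩
  let WS₀ : 𝒢'.V w₀ := W.S ⟨w₀, hw₀⟩
  let jω₀ : WS₀ ⟶ Φ₀.obj YS₀ := j.fS ⟨w₀, hw₀⟩
  haveI : Mono jω₀ := (𝒢'.restrict K).mono_fS j ⟨w₀, hw₀⟩
  let fu₀ : YS₀ ⟶ A.S (φ.base.vertexMap w₀) := f.fS ⟨φ.base.vertexMap w₀, hKV hw₀⟩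
  let sω₀ : T.S w₀ ⟶ Φ₀.obj (A.S (φ.base.vertexMap w₀)) := s.fS w₀
  let y₀ : FY₀.obj YS₀ := F₀.map jω₀ ω₀
  obtain ⟨c₀, y₀', hy₀'⟩ := exists_component_mem_range FY₀ y₀
  haveI : PreGaloisCategory.IsConnected (Subobject.underlying.obj c₀.1) := c₀.2
  haveI : Subsingleton (F₀.obj (T.S w₀)) := subsingleton_fiber_of_isTerminal F₀ (hTV _)
  have hlab₀ : LAB w₀ hw₀ c₀ := by
    obtain ⟨k₀, hk₀⟩ := hsV w₀
    refine (factor_iff_map_mem_range FY₀ (oV w₀).1.arrow (c₀.1.arrow ≫ fu₀) y₀').mpr ⟨F₀.map k₀ t₀, ?_⟩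
    change F₀.map (Φ₀.map (oV w₀).1.arrow) (F₀.map k₀ t₀) = F₀.map (Φ₀.map (c₀.1.arrow ≫ fu₀)) y₀'
    rw [← FintypeCat.comp_apply, ← F₀.map_comp, hk₀, Φ₀.map_comp, F₀.map_comp, FintypeCat.comp_apply]
    change F₀.map sω₀ t₀ = F₀.map (Φ₀.map fu₀) (FY₀.map c₀.1.arrow y₀')
    rw [hy₀']
    exact hω₀.symm
  have hfac₀ : FAC w₀ hw₀ c₀ :=
    exists_hom_sectionFibre_of_mem_range Φ₀ F₀ FY₀ (Iso.refl _) c₀.1.arrow fu₀ sω₀ t₀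
      (hVAK w₀ hw₀ F₀ FY₀ (Iso.refl _) t₀) jω₀ ω₀ ⟨y₀', hy₀'⟩ hω₀
  let vc₀ : Y.fibreData.total.Vertex := ⟨⟨φ.base.vertexMap w₀, hKV hw₀⟩, equivShrink _ c₀⟩
  have hQ₀ : Q (Sum.inl vc₀) := by
    refine ⟨w₀, hw₀, rfl, c₀, ?_, hlab₀, hfac₀⟩
    exact heq_of_eq ((equivShrink _).symm_apply_apply c₀).symm
  -- the end node: the component of `Y_{u₁}` through `η`
  let Φ₁ : 𝒢.V (φ.base.vertexMap w₁) ⥤ 𝒢'.V w₁ := (φ.φV w₁).pullback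
  haveI : PreservesFiniteLimits Φ₁ := (φ.φV w₁).property.1
  haveI : PreservesFiniteColimits Φ₁ := (φ.φV w₁).property.2
  let FY₁ : 𝒢.V (φ.base.vertexMap w₁) ⥤ FintypeCat.{v₁} := Φ₁ ⋙ F₁
  haveI : FiberFunctor FY₁ := fiberFunctor_comp_of_exact _ _
  let YS₁ : 𝒢.V (φ.base.vertexMap w₁) := Y.S ⟨φ.base.vertexMap w₁, hKV hw₁⟩
  let fu₁ : YS₁ ⟶ A.S (φ.base.vertexMap w₁) := f.fS ⟨φ.base.vertexMap w₁, hKV hw₁⟩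
  let sω₁ : T.S w₁ ⟶ Φ₁.obj (A.S (φ.base.vertexMap w₁)) := s.fS w₁
  obtain ⟨c₁, η', hη'⟩ := exists_component_mem_range FY₁ (show FY₁.obj YS₁ from η)
  haveI : PreGaloisCategory.IsConnected (Subobject.underlying.obj c₁.1) := c₁.2
  haveI : Subsingleton (F₁.obj (T.S w₁)) := subsingleton_fiber_of_isTerminal F₁ (hTV _)
  let vc₁ : Y.fibreData.total.Vertex := ⟨⟨φ.base.vertexMap w₁, hKV hw₁⟩, equivShrink _ c₁⟩
  have hvc₁ : Y.vComp vc₁ = c₁ := (equivShrink _).symm_apply_apply c₁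
  obtain ⟨w₃, hw₃, hwu, c₃, hc₃, hlab₃, hfac₃⟩ : QV vc₁ := (hconst (Sum.inl vc₀) (Sum.inl vc₁)).mp hQ₀
  change φ.base.vertexMap w₃ = φ.base.vertexMap w₁ at hwu
  rw [hvc₁] at hc₃
  -- the witness is `w₁`: compare the labels at the section point of `w₁`
  have hx₁ : F₁.map sω₁ t₁ ∈ Set.range (FY₁.map (oV w₁).1.arrow) := by
    obtain ⟨k₁, hk₁⟩ := hsV w₁
    exact ⟨F₁.map k₁ t₁, by
      change F₁.map (Φ₁.map (oV w₁).1.arrow) (F₁.map k₁ t₁) = _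
      rw [← FintypeCat.comp_apply, ← F₁.map_comp, hk₁]⟩
  obtain ⟨m', hm'⟩ := BObj.label_transport A H Y f hwu (hKV hw₃) (hKV hw₁) c₃ c₁ hc₃ (oV w₃) hlab₃
  have hm'' : m' ≫ (hwu ▸ oV w₃ : π₀Obj (A.S (φ.base.vertexMap w₁))).1.arrow = c₁.1.arrow ≫ fu₁ := hm'
  have hx₁' : F₁.map sω₁ t₁ ∈
      Set.range (FY₁.map (hwu ▸ oV w₃ : π₀Obj (A.S (φ.base.vertexMap w₁))).1.arrow) := by
    have hmem := (factor_iff_map_mem_range FY₁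
      (hwu ▸ oV w₃ : π₀Obj (A.S (φ.base.vertexMap w₁))).1.arrow (c₁.1.arrow ≫ fu₁) η').mp ⟨m', hm''⟩
    have he : FY₁.map (c₁.1.arrow ≫ fu₁) η' = F₁.map sω₁ t₁ := by
      rw [FY₁.map_comp, FintypeCat.comp_apply, hη']
      exact hη
    rwa [he] at hmem
  have hP : (hwu ▸ oV w₃ : π₀Obj (A.S (φ.base.vertexMap w₁))) = oV w₁ :=
    component_eq_of_mem_range FY₁ _ _ hx₁' hx₁
  have hw₃₁ : w₃ = w₁ := by
    by_contra hne
    obtain ⟨b', hb'K, hb'w⟩ :=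
      SemiGraph.Subgraph.exists_branch_of_isConnected_of_ne K hK.1 hw₃ hw₁ hne
    exact hne (hoV w₃ w₁ (φ.base.branchMap b') (by rw [φ.base.edgeOf_branchMap]; exact hKE hb'K)
      (φ.base.abuts_branchMap b' w₃ hb'w) (BObj.sigma_mk_eq_of_eqRec_eq A hwu (oV w₃) (oV w₁) hP))
  subst w₃
  have hc₃₁ : c₃ = c₁ := eq_of_heq hc₃
  subst c₃
  -- conclude from the factorisation of the section fibre of `c₁` through `W_{w₁}`
  obtain ⟨g, hg⟩ := hfac₃
  obtain ⟨κ, hκ⟩ := (mem_range_sectionFibre_iff Φ₁ F₁ c₁.1.arrow fu₁ sω₁ t₁ η).mpr ⟨⟨η', hη'⟩, hη⟩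
  refine ⟨F₁.map g κ, ?_⟩
  rw [← FintypeCat.comp_apply, ← F₁.map_comp, hg]
  exact hκ

end SemiGraphOfAnabelioids

end Literature.AnabelianGeometry.SemiGraphs
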